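import Summits.HubbardSuperconductivity.HubbardSuperconductivity.Theses.TorusCooperLog
import Summits.HubbardSuperconductivity.HubbardSuperconductivity.Theorems.BalabanIRBirEveryGroundState
import Summits.HubbardSuperconductivity.HubbardSuperconductivity.Theorems.BalabanIRBirEveryGroundStateSchur
import HarnessLib

/-!
# Crux `CwThesis` (stmt-HubbardSuperconductivity-10438, route `ChiralWindow`), line
`SketchIdeator3` (penalty line, thermal form) — stub `stub_penaltyResponseLRO`

**Penalty response ⇒ the summit matrix.** This module ALSO proves, verbatim (the theorem's type IS
that route declaration), the support item `TorusCooperLog.PenaltyResponseLRO`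
(stmt-HubbardSuperconductivity-10879) of route `TorusCooperLog`, which may therefore be closed
`--by Summit.HubbardSuperconductivity.HubbardSuperconductivity.Theorems.CwThesis.stub_penaltyResponseLRO`.

Statement: for fixed `(U, δ, κ > 0, c > 0)`, an eventual intensive penalty response
`c·κ ≤ E_L(U;κ) - E_L(U;0)` along the even sides `L = 2(k+1)`, where
`E_L(U;κ) = minEnergyOn (hubbardTorus 2 L 1 U + (κ/L⁴)·Δ_d†Δ_d) (szSector N_L 0)`,
`N_L = 2⌊(1-δ)L²/2⌋`, `Δ_d = pairField dWaveFormFactor L`, implies the summit matrix at `(U, δ)`: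
every admissible sequence `(N, ψ)` of normalised `(N_L, S^z = 0)`-sector ground states on even tori
has `HasLongRangeOrder` of `torusPullback (pairFieldCorr dWaveFormFactor ψ) (2k)` over
`halfOpenBox 2 (2k)`.

Proof (one variational step + the tree's LRO bookkeeping): from the eventual response get a
threshold `k₀`; for even `L = 2(k+1) ≥ 2(k₀+1)` and a normalised sector ground state `ψ`, the chord
inequality `chord_div_le_re_expect_of_eigen` with `Y = L⁻⁴ Δ_d†Δ_d` gives
`c ≤ (E_L(U;κ) - E_L(U;0))/κ ≤ re ⟨ψ, Y ψ⟩ = L⁻⁴ re ⟨ψ, Δ_d†Δ_d ψ⟩`, i.e. the every-ground-state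
bound `c L⁴ ≤ re ⟨ψ, Δ_d†Δ_d ψ⟩`; `hasLRO_of_forall_groundState_bound` turns it into the conclusion.

Griffiths (1966); Kato (1966) II §5.4; Tasaki (2020) §2.1 (2.1.6); Scalapino, Phys. Rep. 250 (1995)
§2 eq. (2.4). No definition is introduced. [folklore]
-/

noncomputable section

namespace Summit.HubbardSuperconductivity.HubbardSuperconductivity.Theorems.CwThesis

-- `dupNamespace`: the summit and the problem are both named `HubbardSuperconductivity` (layout D-0022)
set_option linter.dupNamespace false

open Matrix Filter Literature.MathematicalPhysics.QuantumLattice Literature.Probability.LatticeModels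
open scoped ComplexOrder

/-- **Penalty response ⇒ the summit matrix** (`TorusCooperLog.PenaltyResponseLRO`,
stmt-HubbardSuperconductivity-10879, verbatim). An eventual intensive penalty response
`c·κ ≤ E_L(U;κ) - E_L(U;0)` along `L = 2(k+1)` forces, by the chord inequality
(`chord_div_le_re_expect_of_eigen` with `Y = L⁻⁴ Δ_d†Δ_d`), `c L⁴ ≤ re ⟨ψ, Δ_d†Δ_d ψ⟩` for EVERY
normalised sector ground state `ψ`, and `hasLRO_of_forall_groundState_bound` turns that into the
summit's `HasLongRangeOrder` conclusion for every admissible sequence. [folklore] -/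
theorem stub_penaltyResponseLRO :
    Summit.HubbardSuperconductivity.HubbardSuperconductivity.Theses.TorusCooperLog.PenaltyResponseLRO := by
  -- adapted from …Theorems.BalabanIRBirEveryGroundStateClosures.birEveryGroundState_of_kappaChord
  unfold Summit.HubbardSuperconductivity.HubbardSuperconductivity.Theses.TorusCooperLog.PenaltyResponseLRO
  intro U δ κ c hκ hc hev N ψ hadm
  obtain ⟨k₀, hk₀⟩ := Filter.eventually_atTop.1 hev
  refine hasLRO_of_forall_groundState_bound U δ c hc (2 * (k₀ + 1)) ?_ N ψ hadm
  intro L _ hL hLe φ hgs hunit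
  -- write the even side as `L = 2(k+1)` with `k ≥ k₀`
  obtain ⟨r, hr⟩ := hLe
  obtain ⟨k, hk, rfl⟩ : ∃ k, k₀ ≤ k ∧ L = 2 * (k + 1) := ⟨r - 1, by omega, by omega⟩
  have hgap := hk₀ k hk
  -- name the objects of side `2(k+1)`
  set A : Matrix (Finset (Orb (FermionTorus 2 (2 * (k + 1)))))
      (Finset (Orb (FermionTorus 2 (2 * (k + 1))))) ℂ :=
    (pairField dWaveFormFactor (2 * (k + 1)))ᴴ * pairField dWaveFormFactor (2 * (k + 1)) with hA
  set H := hubbardTorus 2 (2 * (k + 1)) 1 U with hH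
  set S := szSector (Λ := FermionTorus 2 (2 * (k + 1)))
    (2 * ⌊(1 - δ) * ((2 * (k + 1) : ℕ) : ℝ) ^ 2 / 2⌋₊) 0 with hS
  set Yd : Matrix (Finset (Orb (FermionTorus 2 (2 * (k + 1)))))
      (Finset (Orb (FermionTorus 2 (2 * (k + 1))))) ℂ :=
    ((1 : ℂ) / ((2 * (k + 1) : ℕ) : ℂ) ^ 4) • A with hYd
  -- the penalty `(κ/L⁴) Δ_d†Δ_d` is `κ • Y_L`
  have hsmul : (((κ / ((2 * (k + 1) : ℕ) : ℝ) ^ 4 : ℝ)) : ℂ) • A = (κ : ℂ) • Yd := by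
    rw [hYd, smul_smul]
    congr 1
    push_cast
    ring
  rw [hsmul] at hgap
  -- the chord inequality for the ground state `φ`
  have hch := chord_div_le_re_expect_of_eigen H Yd S hκ hgs.1 hunit hgs.2.2
  have hL4 : (0 : ℝ) < ((2 * (k + 1) : ℕ) : ℝ) ^ 4 := by positivity
  -- `⟨φ, Y_L φ⟩ = L⁻⁴ ⟨φ, Δ_d† Δ_d φ⟩`
  have hexp : (star φ ⬝ᵥ Yd *ᵥ φ).re = (star φ ⬝ᵥ A *ᵥ φ).re / ((2 * (k + 1) : ℕ) : ℝ) ^ 4 := by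
    have hcast : ((1 : ℂ) / ((2 * (k + 1) : ℕ) : ℂ) ^ 4) =
        (((1 : ℝ) / ((2 * (k + 1) : ℕ) : ℝ) ^ 4 : ℝ) : ℂ) := by
      push_cast
      ring
    rw [hYd, smul_mulVec, dotProduct_smul, smul_eq_mul, hcast, Complex.re_ofReal_mul]
    ring
  have hc' : c ≤ ((H + (κ : ℂ) • Yd).minEnergyOn S - H.minEnergyOn S) / κ := by
    rw [le_div_iff₀ hκ]
    exact hgap
  have key : c ≤ (star φ ⬝ᵥ A *ᵥ φ).re / ((2 * (k + 1) : ℕ) : ℝ) ^ 4 := by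
    rw [← hexp]
    exact hc'.trans hch
  rwa [le_div_iff₀ hL4] at key

end Summit.HubbardSuperconductivity.HubbardSuperconductivity.Theorems.CwThesis

end
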